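import Summits.NavierStokesRegularity.FunctionalMining.TopEigLaminateClass
import HarnessLib

/-!
# FunctionalMining / NoGo — K69: the EVERYWHERE-SIMPLE CLASS of `T³` is NON-EMPTY and CALIBRATED —
# the helical shear `w = (sin 2πx₂, cos 2πx₂, 0)` has strain spectrum `(π, 0, −π)` at EVERY point and
# `heatDissipation Φ_q w = 4π²q · Φ_q(w)`; hence the rate ceiling `c ≤ 4π²q` holds ON the simple class

HONEST FRAMING. Search for candidate a priori estimates; no regularity claim. Nothing about
Navier–Stokes is proved or asserted in this file. Cell `pub-nsfunc`, no-go seat (gen 54). Door (e) box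
of `NOGO.md` (STRUCTURE ONLY), bookkeeping for the open node Lemma L-λ(q) = `TopEigHeatCoercivePos q`
(`Φ_q = torusTopEigMoment q = ∫ (λ₁⁺)^q`, `λ₁ ≥ λ₂ ≥ λ₃` the strain eigenvalues; door (b)/(F2)
wants `¬ TopEigHeatCoercivePos q`).
WHY. The structural rules K62–K68 (`NoGo/TopEigHeatFrameFloor … NoGo/TopEigHeatChannelRule`) and the
tree's `TopEigGapCoerciveSimple` / `TopEigChannelIntegralSimple` are all stated on the class of smooth
divergence-free fields whose top strain eigenvalue is SIMPLE AT EVERY POINT (`∀ x, λ₂(x) < λ₁(x)`). The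
tree's calibration fields do NOT lie in that class: the unidirectional laminates `(F(x₂), 0, 0)`
(`TopEigLaminateTwo`) and the crossed shears (`CrossedShearField`) have strain zeros (`F′`
vanishes somewhere; `cos 2πx₀ = 0`), where `λ₁ = λ₂ = λ₃ = 0`. This file records, kernel-checked, that
the class is non-empty, contains a FIRST-SHELL EIGENFIELD, and therefore carries the same rate
ceiling as the full node — so none of the everywhere-simple rules is vacuous, and none can be improved
to a rate above `4π²q` on that class.
THE WITNESS. `helShear = lamV e₂ helPol`, the tree's laminate (`TopEigLaminateRigid.lamV`) with
lattice direction `e₂ = (0,0,1)` and polarisation `helPol = (sin 2πt, cos 2πt, 0)`: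
`w(x) = (sin 2πx₂, cos 2πx₂, 0)` (a circularly polarised shear wave / Beltrami field, `curl w = −2πw`).
CONTENT. § 1 `w` is smooth, divergence free, mean zero, `Δw = −4π²w`, `‖w(x)‖ = 1`.
§ 2 **`torusStrainTopEig_helShear` / `torusStrainMidEig_helShear` / `torusStrainBotEig_helShear`**:
`λ₁ ≡ π`, `λ₂ ≡ 0`, `λ₃ ≡ −π` (the strain is the plane shear `sym(a ⊗ e₂)`, `a = w′ ⊥ e₂`,
`|a| = 2π`; tree `lam_shearT`, `midEig_lamV`); hence **`midEig_lt_topEig_helShear`**: `w` is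
everywhere simple (indeed all three eigenvalues are distinct everywhere, gap `λ₁ − λ₂ ≡ π`).
§ 3 **`torusTopEigMoment_helShear`**: `Φ_q(w) = π^q` (every real `q`), and
**`heatDissipation_topEigMoment_helShear`**: `heatDissipation Φ_q w = 4π²q · Φ_q(w)` (`q ≥ 1`; tree
first-shell calibration `heatDissipation_topEigMoment_of_laplacian_eq`).
§ 4 **`exists_everywhereSimple_calibrated`**: the hypothesis set "smooth, div-free, mean zero, `λ₂ < λ₁`
everywhere, `Φ_q > 0`" of K62–K68 is satisfiable, by a field with `heat = 4π²q·Φ_q`; and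
**`heatCoerciveOn_simple_rate_le`**: `HeatCoerciveOn (λ₂ < λ₁ everywhere) Φ_q c → c ≤ 4π²q`
(`q ≥ 1`) — the tree's ceiling `topEigHeatCoercive_rate_le` survives restriction to the everywhere-simple class.
MEANING FOR (F2) (records only). On the everywhere-simple class the best constant of Lemma L-λ(q) lies in
`[0, 4π²q]`, the upper end ATTAINED inside the class by `w` (at `q = 2`: `8π² = ` the laminate-rigidity
rate of `TopEigLaminateRigid`, equality case); the inverse-gap / channel rules K65–K68 evaluated at `w`
are finite identities with gap weight `qπ^{q−1}·π` and `∫‖w‖² = 1` (pen remark; not restated here).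
WHAT THIS IS NOT. Not a killing family and no step towards one: `w` is the OPPOSITE extreme (maximal
rate). Everything is [ours] = elementary bookkeeping on tree objects, or [tree].
FILING (prove seat g31, REQUEST #98): declarations byte-identical to the no-go seat's staged `TopEigHeatSimpleWitness.STAGING.lean` d8512489abfc0fda; this line is the only addition.
-/

noncomputable section

open MeasureTheory Set intervalIntegral

namespace Summit.NavierStokesRegularity.FunctionalMining

open Literature.Analysis Literature.Analysis.FunctionSpaces Literature.Analysis.FunctionSpaces.Torus
open Literature.Analysis.FluidPDE Literature.Analysis.FluidPDE.Torus
open TopEig StrainL4 LaminateDirection TopEigLaminate CrossedShear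

namespace TopEig

/-! ## 1. The helical shear -/

/-- The polarisation `(sin 2πt, cos 2πt, 0)` (third profile: the zero profile `sinP.scale 0 0`).
[ours, bookkeeping] -/
def helPol : Fin 3 → ShearProfile := ![sinP, cosP, sinP.scale 0 0]

/-- **The helical shear** `w(x) = (sin 2πx₂, cos 2πx₂, 0)`, as the tree laminate `lamV e₂ helPol`.
Search for candidate a priori estimates; no regularity claim. [ours] -/
def helShear : UnitAddTorus (Fin 3) → EuclideanSpace ℝ (Fin 3) := lamV e2 helPol

/-- The three profiles by index. [ours, bookkeeping] -/
@[simp] private theorem helPol_zero : helPol 0 = sinP := rfl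

/-- The three profiles by index. [ours, bookkeeping] -/
@[simp] private theorem helPol_one : helPol 1 = cosP := rfl

/-- The third profile vanishes identically. [ours, bookkeeping] -/
@[simp] private theorem helPol_two_apply (t : ℝ) : helPol 2 t = 0 := by
  show (sinP.scale 0 0) t = 0
  rw [ShearProfile.scale_apply, zero_mul]

/-- `sin″ = −4π² sin`, `cos″ = −4π² cos`, `0′ = 0″ = 0` for the three profiles, and their first
derivatives. [folklore] -/
private theorem helPol_D (t : ℝ) :
    (helPol 0).D t = 2 * Real.pi * cosP t ∧ (helPol 1).D t = -(2 * Real.pi * sinP t) ∧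
      (helPol 2).D t = 0 ∧ (helPol 0).D.D t = -(4 * Real.pi ^ 2) * sinP t ∧
      (helPol 1).D.D t = -(4 * Real.pi ^ 2) * cosP t ∧ (helPol 2).D.D t = 0 := by
  have h0 : ((helPol 0).D : ℝ → ℝ) = fun s => (2 * Real.pi) * cosP s := funext deriv_sinP
  have h1 : ((helPol 1).D : ℝ → ℝ) = fun s => (-(2 * Real.pi)) * sinP s :=
    funext fun s => by rw [helPol_one, ShearProfile.D_apply, deriv_cosP]; ring
  have h2f : ((helPol 2 : ShearProfile) : ℝ → ℝ) = fun _ => 0 := funext helPol_two_apply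
  have h2 : ((helPol 2).D : ℝ → ℝ) = fun _ => 0 := by
    rw [ShearProfile.coe_D, h2f]; funext s; exact deriv_const s 0
  refine ⟨by rw [helPol_zero, ShearProfile.D_apply, deriv_sinP],
    by rw [helPol_one, ShearProfile.D_apply, deriv_cosP], by rw [h2], ?_, ?_, ?_⟩
  · rw [ShearProfile.D_apply, h0, deriv_const_mul _ (hasDerivAt_cosP t).differentiableAt, deriv_cosP]
    ring
  · rw [ShearProfile.D_apply, h1, deriv_const_mul _ (hasDerivAt_sinP t).differentiableAt, deriv_sinP]
    ring
  · rw [ShearProfile.D_apply, h2]; exact deriv_const t 0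

/-- `e₂ · helPol′ ≡ 0` (the laminate divergence condition). [ours, bookkeeping] -/
theorem helPol_div (s : ℝ) : ∑ i, (e2 i : ℝ) * (helPol i).D s = 0 := by
  rw [Fin.sum_univ_three, e2_apply, e2_apply, e2_apply, (helPol_D s).2.2.1]
  simp

/-- `w` is smooth. [ours, bookkeeping] -/
theorem isSmooth_helShear : IsSmooth helShear := isSmooth_lamV e2 helPol

/-- `w` is divergence free. [ours, bookkeeping] -/
theorem isDivFree_helShear : IsDivFree helShear := isDivFree_lamV helPol_div

/-- Coordinates: `w(x) = (sin 2πt, cos 2πt, 0)` at any real representative `t` of `x₂`.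
[ours, bookkeeping] -/
theorem helShear_apply_of_rep {x : UnitAddTorus (Fin 3)} {t : ℝ}
    (ht : ∀ P : ShearProfile, dirFun e2 P x = P t) :
    helShear x 0 = sinP t ∧ helShear x 1 = cosP t ∧ helShear x 2 = 0 := by
  refine ⟨?_, ?_, ?_⟩ <;> rw [helShear, lamV_apply, ht] <;> simp

/-- `‖w(x)‖² = 1` everywhere. [ours, bookkeeping] -/
theorem norm_helShear_sq (x : UnitAddTorus (Fin 3)) : ‖helShear x‖ ^ 2 = 1 := by
  obtain ⟨t, ht⟩ := exists_dirFun_eq e2 x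
  obtain ⟨h0, h1, h2⟩ := helShear_apply_of_rep ht
  rw [EuclideanSpace.real_norm_sq_eq, Fin.sum_univ_three, h0, h1, h2, sinP_apply, cosP_apply]
  nlinarith [Real.sin_sq_add_cos_sq (2 * Real.pi * t)]

/-- `w` has zero mean. [ours, bookkeeping] -/
theorem hasZeroMean_helShear : HasZeroMean helShear := by
  show ∫ x, helShear x = 0
  have hi : ∀ i : Fin 3, Integrable fun x => dirFun e2 (helPol i) x • EuclideanSpace.single i (1 : ℝ) :=
    fun i => ((isSmooth_dirFun e2 _).continuous.smul continuous_const).integrable_unitAddTorus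
  have hS : ∫ x, dirFun e2 sinP x = 0 := by
    simpa [intervalIntegral_sinP] using integral_dirFun_comp (k := e2) e2_ne_zero sinP continuous_id
  have hC : ∫ x, dirFun e2 cosP x = 0 := by
    simpa [intervalIntegral_cosP] using integral_dirFun_comp (k := e2) e2_ne_zero cosP continuous_id
  have hZ : ∫ x, dirFun e2 (helPol 2) x = 0 := by
    have : ∀ x, dirFun e2 (helPol 2) x = 0 := fun x => by
      obtain ⟨t, ht⟩ := exists_dirFun_eq e2 x
      rw [ht, helPol_two_apply]
    simp [this]
  have h01 : Integrable fun x => dirFun e2 (helPol 0) x • EuclideanSpace.single (0 : Fin 3) (1 : ℝ) +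
      dirFun e2 (helPol 1) x • EuclideanSpace.single (1 : Fin 3) (1 : ℝ) := (hi 0).add (hi 1)
  unfold helShear lamV
  rw [integral_add h01 (hi 2), integral_add (hi 0) (hi 1), _root_.integral_smul_const,
    _root_.integral_smul_const, _root_.integral_smul_const, helPol_zero, helPol_one, hS, hC, hZ]
  simp

/-- **`Δw = −4π² w`** (first shell). [ours, bookkeeping] -/
theorem laplacian_helShear : Torus.laplacian helShear = -((4 * Real.pi ^ 2) • helShear) := by
  have hk : kR e2 ⬝ᵥ kR e2 = 1 := by rw [kR_dot, Fin.sum_univ_three]; simp [e2]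
  rw [helShear, laplacian_lamV, hk, one_smul, ← neg_smul]
  funext x
  obtain ⟨t, ht⟩ := exists_dirFun_eq e2 x
  obtain ⟨-, -, -, d0, d1, d2⟩ := helPol_D t
  ext i
  simp only [Pi.smul_apply, PiLp.smul_apply, smul_eq_mul, lamV_apply, ht]
  fin_cases i
  · exact d0
  · exact d1
  · show (helPol 2).D.D t = -(4 * Real.pi ^ 2) * helPol 2 t
    rw [d2, helPol_two_apply, mul_zero]

/-! ## 2. The strain spectrum is `(π, 0, −π)` at every point -/

/-- The profile vector `a = w′(x₂) = (2π cos 2πt, −2π sin 2πt, 0)`: `a ⊥ e₂`, `|a|² = 4π²`.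
[ours] -/
private theorem aVec_helPol {x : UnitAddTorus (Fin 3)} {t : ℝ}
    (ht : ∀ P : ShearProfile, dirFun e2 P x = P t) :
    aVec (k := e2) helPol x ⬝ᵥ kR e2 = 0 ∧
      aVec (k := e2) helPol x ⬝ᵥ aVec (k := e2) helPol x = (2 * Real.pi) ^ 2 ∧
      kR e2 ⬝ᵥ kR e2 = 1 := by
  obtain ⟨d0, d1, d2, -, -, -⟩ := helPol_D t
  have ha : ∀ i, aVec (k := e2) helPol x i = (helPol i).D t := fun i => by
    show dirFun e2 ((helPol i).D) x = _; rw [ht]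
  refine ⟨?_, ?_, by rw [kR_dot, Fin.sum_univ_three]; simp [e2]⟩
  · simp only [dotProduct, Fin.sum_univ_three, ha, d2, kR, e2_apply]; simp
  · simp only [dotProduct, Fin.sum_univ_three, ha, d0, d1, d2, sinP_apply, cosP_apply]
    nlinarith [Real.sin_sq_add_cos_sq (2 * Real.pi * t)]

/-- **`λ₁(w)(x) = π` at every point.** [ours] -/
theorem torusStrainTopEig_helShear (x : UnitAddTorus (Fin 3)) : torusStrainTopEig helShear x = Real.pi := by
  obtain ⟨t, ht⟩ := exists_dirFun_eq e2 x
  obtain ⟨hak, haa, hkk⟩ := aVec_helPol ht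
  rw [← lam_strainFlat, helShear, strainFlat_lamV, lam_shearT hak, haa, hkk, mul_one,
    Real.sqrt_sq (by positivity)]
  ring

/-- **`λ₃(w)(x) = −π` at every point.** [ours] -/
theorem torusStrainBotEig_helShear (x : UnitAddTorus (Fin 3)) : torusStrainBotEig helShear x = -Real.pi := by
  obtain ⟨t, ht⟩ := exists_dirFun_eq e2 x
  obtain ⟨hak, haa, hkk⟩ := aVec_helPol ht
  have hnak : (-aVec (k := e2) helPol x) ⬝ᵥ kR e2 = 0 := by rw [neg_dotProduct, hak, neg_zero]
  have h := lam_neg_strainFlat helShear x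
  rw [helShear, strainFlat_lamV, neg_shearT, lam_shearT hnak, neg_dotProduct, dotProduct_neg, neg_neg, haa,
    hkk, mul_one, Real.sqrt_sq (by positivity)] at h
  rw [helShear]
  linarith

/-- **`λ₂(w)(x) = 0` at every point** (tree `midEig_lamV`: `λ₂ ≡ 0` for every laminate). [tree] -/
theorem torusStrainMidEig_helShear (x : UnitAddTorus (Fin 3)) : torusStrainMidEig helShear x = 0 :=
  midEig_lamV helPol_div x

/-- **`w` is everywhere simple**: `λ₂(x) < λ₁(x)` (indeed `λ₃ < λ₂ < λ₁`, gap `λ₁ − λ₂ ≡ π`) at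
every point. [ours] -/
theorem midEig_lt_topEig_helShear (x : UnitAddTorus (Fin 3)) :
    torusStrainMidEig helShear x < torusStrainTopEig helShear x ∧
      torusStrainBotEig helShear x < torusStrainMidEig helShear x ∧
      torusStrainTopEig helShear x - torusStrainMidEig helShear x = Real.pi := by
  rw [torusStrainMidEig_helShear, torusStrainTopEig_helShear, torusStrainBotEig_helShear]
  exact ⟨Real.pi_pos, by linarith [Real.pi_pos], sub_zero _⟩

/-! ## 3. The moments and the heat dissipation -/

/-- **`Φ_q(w) = π^q`** for every real `q`. [ours] -/
theorem torusTopEigMoment_helShear (q : ℝ) : torusTopEigMoment q helShear = Real.pi ^ q := by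
  rw [torusTopEigMoment]
  simp_rw [torusStrainTopEig_helShear, max_eq_left Real.pi_pos.le]
  rw [MeasureTheory.integral_const, smul_eq_mul]
  simp

/-- `Φ_q(w) > 0`. [ours, bookkeeping] -/
theorem torusTopEigMoment_helShear_pos (q : ℝ) : 0 < torusTopEigMoment q helShear := by
  rw [torusTopEigMoment_helShear]; exact Real.rpow_pos_of_pos Real.pi_pos q

/-- **`heatDissipation Φ_q w = 4π²q · Φ_q(w)`** (`q ≥ 1`): the first-shell calibration, attained INSIDE
the everywhere-simple class. [ours; tree `heatDissipation_topEigMoment_of_laplacian_eq`] -/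
theorem heatDissipation_topEigMoment_helShear {q : ℝ} (hq : 1 ≤ q) :
    heatDissipation (torusTopEigMoment q) helShear = 4 * Real.pi ^ 2 * q * torusTopEigMoment q helShear := by
  rw [heatDissipation_topEigMoment_of_laplacian_eq hq (by positivity : (0 : ℝ) ≤ 4 * Real.pi ^ 2)
    isSmooth_helShear laplacian_helShear]
  ring

/-- At `q = 2`: `heatDissipation Φ₂ w = 8π² · Φ₂(w)` — the laminate-rigidity rate `8π²` of the
tree's `laminate_rigid_two_V'` (`8π²Φ₂ ≤ heat` for every laminate) is ATTAINED, by an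
everywhere-simple laminate. [ours, calibration] -/
theorem heatDissipation_topEigMoment_two_helShear :
    heatDissipation (torusTopEigMoment 2) helShear = 8 * Real.pi ^ 2 * torusTopEigMoment 2 helShear := by
  rw [heatDissipation_topEigMoment_helShear (by norm_num : (1 : ℝ) ≤ 2)]
  ring

/-! ## 4. Non-vacuity of the everywhere-simple rules and the rate ceiling on the simple class -/

/-- **THE EVERYWHERE-SIMPLE CLASS IS NON-EMPTY AND CALIBRATED**: there is a smooth divergence-free
mean-zero field on `T³` with `λ₃ < λ₂ < λ₁` at every point, `Φ_q > 0` for every real `q`, and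
`heatDissipation Φ_q = 4π²q · Φ_q` for every `q ≥ 1`. Search for candidate a priori estimates; no
regularity claim. [ours] -/
theorem exists_everywhereSimple_calibrated :
    ∃ v : UnitAddTorus (Fin 3) → EuclideanSpace ℝ (Fin 3),
      IsSmooth v ∧ IsDivFree v ∧ HasZeroMean v ∧ (∀ x, torusStrainMidEig v x < torusStrainTopEig v x) ∧
      (∀ x, torusStrainBotEig v x < torusStrainMidEig v x) ∧ (∀ q : ℝ, 0 < torusTopEigMoment q v) ∧
      ∀ q : ℝ, 1 ≤ q →
        heatDissipation (torusTopEigMoment q) v = 4 * Real.pi ^ 2 * q * torusTopEigMoment q v :=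
  ⟨helShear, isSmooth_helShear, isDivFree_helShear, hasZeroMean_helShear,
    fun x => (midEig_lt_topEig_helShear x).1, fun x => (midEig_lt_topEig_helShear x).2.1,
    torusTopEigMoment_helShear_pos, fun _ hq => heatDissipation_topEigMoment_helShear hq⟩

/-- **RATE CEILING ON THE SIMPLE CLASS**: heat coercivity of `Φ_q` restricted to the everywhere-simple
fields still forces `c ≤ 4π²q` (`q ≥ 1`) — the tree's `topEigHeatCoercive_rate_le` survives the
restriction, with the helical shear in place of the crossed shear. [ours, calibration] -/
theorem heatCoerciveOn_simple_rate_le {q c : ℝ} (hq : 1 ≤ q)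
    (h : HeatCoerciveOn (d := Fin 3) (fun v => ∀ x, torusStrainMidEig v x < torusStrainTopEig v x)
      (torusTopEigMoment q) c) : c ≤ 4 * Real.pi ^ 2 * q := by
  have hL := h (by simp) helShear isSmooth_helShear isDivFree_helShear hasZeroMean_helShear
    fun x => (midEig_lt_topEig_helShear x).1
  rw [heatDissipation_topEigMoment_helShear hq] at hL
  exact le_of_mul_le_mul_right (by linarith) (torusTopEigMoment_helShear_pos q)

/-- The same ceiling for the unrestricted node, re-derived through the simple class (tree
`topEigHeatCoercive_rate_le`, now with an everywhere-simple witness). [ours, calibration] -/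
theorem topEigHeatCoercive_rate_le_of_simple_witness {q c : ℝ} (hq : 1 ≤ q)
    (h : TopEigHeatCoercive (d := Fin 3) q c) : c ≤ 4 * Real.pi ^ 2 * q :=
  heatCoerciveOn_simple_rate_le hq fun hd v hv hdiv hmean _ => h hd v hv hdiv hmean

end TopEig

end Summit.NavierStokesRegularity.FunctionalMining

end
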